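import Summits.Ventures.LatticeQCDFlow.Scaling.SimulatedTemperingFiniteSampler
import Summits.Ventures.LatticeQCDFlow.Scaling.ReplicaExchangeFiniteSampler
import Literature.Probability.MarkovChains.BottleneckRatio

/-!
HONEST FRAMING: exact (Metropolis-corrected) sampling algorithms for lattice gauge theory; figures
of merit are autocorrelation/cost numbers at stated couplings and volumes; no continuum-physics
claim.

# LevelSchemeBallisticFloor — ORDER `K` IS THE FLOOR FOR EVERY LEVEL SCHEME THAT CLIMBS AT MOST ONE LEVEL PER STEP,
# REVERSIBLE OR NOT: FOR ANY TRANSITION MATRIX `P` ON `Fin (K+1) × S` WITH `P((k,x),(l,y)) ≠ 0 ⇒ l ≤ k + 1`,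
# `d(n) ≥ (K − n)/(K+1)` AGAINST THE EXACT-WEIGHT TARGET, HENCE `d(n) ≤ ¼ ⇒ n ≥ (3K − 1)/4` — NO STATIONARITY, NO
# REVERSIBILITY, NO ASSUMPTION ON THE PROPOSAL, THE WEIGHTS IT WAS TRAINED WITH, OR THE WITHIN-LEVEL ALGORITHM
# (lean-2 GEN-20, ours)

Venture-side (OURS).  Cell `lqcd-flow` (pub-lqcd), unit `pub-lqcd-lean-2-g20`, 2026-08-25.  Chapter H (universal
ceilings).  `AdjacentLevelSchemeDiffusiveCeiling` shows that every REVERSIBLE adjacent level scheme of simulated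
tempering needs order `K²` steps; lifted / non-reversible level sweeps (irreversible simulated tempering, the
tempering analogue of non-reversible parallel tempering) escape that file by design.  This file is the floor NOTHING
escapes: a walker that rises at most one level per step is, after `n` steps from the bottom level, still at level `≤ n`,
while the exact-weight target `π(k,x) = μ_k(x)/(K+1)` (`stFinLaw μ`) puts mass `(K−n)/(K+1)` above level `n`.  Setting
of `SimulatedTemperingFiniteSampler` (state `(k,x) ∈ Fin (K+1) × S`, `S` finite, `Σ_x μ_k(x) = 1`); `d(n) = worstTvDist`,
`t_mix = mixingTime … (1/4)` (Literature `BottleneckRatio`).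

## What is proved (finite-chain vocabulary of `Literature.Probability.MarkovChains`)

* §1 `stFin_mass_levelSet` — `π({level ∈ C}) = #C/(K+1)` for every set of levels `C`.
* §2 ANY `P` (row-stochastic) whose steps raise the level by at most one (`hup : P(p,q) ≠ 0 ⇒ q.1 ≤ p.1 + 1`; downward
  jumps of any size allowed): `lawAt_single_eq_zero_above` (from `(0,x₀)`, no mass above level `n` at time `n`);
  **`levelRise_worstTvDist_ge`** — `(K − n) ≤ (K+1)·d(n)`; **`levelRise_mixing_floor`** — `d(n) ≤ ¼ ⇒ 3K ≤ 4n + 1`;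
  **`levelRise_mixingTime_ge`** — `3K ≤ 4·t_mix + 1` (some time being `¼`-close).
* §3 instances: **`levelScheme_mixing_ballistic`** — `P = t·Q + (1−t)·stFinWithin M` for ANY row-stochastic level
  move `Q` rising at most one level per step (`0 ≤ t ≤ 1`, `M_k` row-stochastic; nothing else);
  **`stFin_mixing_ballistic`** — the Metropolis sampler `stFinSampler t μ M`; **`ptFin_mixing_ballistic`** — REPLICA
  EXCHANGE (`ptFinSampler t μ M` of `ReplicaExchangeFiniteSampler`, target `ptFinLaw μ` = uniform tag × `⊗μ_k`): the
  TAGGED replica climbs one rung per swap, so the (tag, configurations) law needs `(3K−1)/4` steps too.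

Reading (no numerics implied): the relaxation of a tempering sampler in the coupling is pinned between order `K`
(this file, every scheme) and order `K²` (reversible adjacent schemes, `AdjacentLevelSchemeDiffusiveCeiling`; the
Metropolis sampler attains `K²`, `SimulatedTemperingFiniteCeiling`/`FiniteFloor`); the factor `K` in between is the
most that lifting / non-reversibility of the level dynamics can buy (the known gain of lifted walks on a path,
Diaconis–Holmes–Neal 2000; of non-reversible tempering schedules) — and only if the within-level updates keep up.
NOT CLAIMED: that any scheme attains order `K`; replica exchange (the tagged-replica analogue is the same argument, not
typed here); anything measured.  Literature grade (cell rule): KNOWN MECHANISM (speed-one support bound / diameter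
lower bound for mixing, Levin–Peres–Wilmer §7.1.2), NEW TYPING (exact-weight level schemes, arbitrary kernels); nothing
cited as a fact; no new bib keys.
-/

noncomputable section

open Finset Function
open Literature.Probability.MarkovChains

namespace Summit.Ventures.LatticeQCDFlow.Scaling

variable {S : Type*} [Fintype S] {K : ℕ} {μ : Fin (K + 1) → S → ℝ}
  {M : Fin (K + 1) → Matrix S S ℝ} {t : ℝ}

/-! ## §1 The mass of a set of levels -/

/-- **`π({level ∈ C}) = #C/(K+1)`** (exact weights: the level marginal is uniform). [ours] -/
theorem stFin_mass_levelSet (hμ1 : ∀ k, ∑ x, μ k x = 1) (C : Finset (Fin (K + 1))) :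
    ∑ p ∈ univ.filter (fun p : Fin (K + 1) × S => p.1 ∈ C), stFinLaw μ p = (C.card : ℝ) / (K + 1) := by
  rw [sum_filter, Fintype.sum_prod_type]
  have h : ∀ k : Fin (K + 1), ∑ x : S, (if ((k, x) : Fin (K + 1) × S).1 ∈ C then stFinLaw μ (k, x) else 0)
      = if k ∈ C then (1 : ℝ) / (K + 1) else 0 := fun k => by
    split_ifs with hk
    · unfold stFinLaw; rw [← sum_div, hμ1 k]
    · simp
  simp_rw [h]
  rw [← sum_filter, Finset.filter_mem_eq_inter, Finset.univ_inter, sum_const, nsmul_eq_mul]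
  ring

/-! ## §2 A walker rising one level per step: the ballistic floor -/

section Rise

variable [DecidableEq S] {P : Matrix (Fin (K + 1) × S) (Fin (K + 1) × S) ℝ}

/-- **No mass above level `n` at time `n` from the bottom level** (`P(p,q) ≠ 0 ⇒ q.1 ≤ p.1 + 1`). [ours] -/
theorem lawAt_single_eq_zero_above (hup : ∀ p q, P p q ≠ 0 → (q.1 : ℕ) ≤ p.1 + 1) (x₀ : S) (n : ℕ)
    (q : Fin (K + 1) × S) (hq : n < (q.1 : ℕ)) : lawAt P (Pi.single ((0 : Fin (K + 1)), x₀) 1) n q = 0 := by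
  induction n generalizing q with
  | zero =>
    rw [lawAt_zero]
    have hne : q ≠ ((0 : Fin (K + 1)), x₀) := fun e => by rw [e] at hq; simp at hq
    simp [hne]
  | succ n ih =>
    rw [lawAt_succ]
    refine sum_eq_zero fun p _ => ?_
    by_cases hp : n < (p.1 : ℕ)
    · rw [ih p hp, zero_mul]
    · have hP0 : P p q = 0 := by
        by_contra h
        have := hup p q h
        omega
      rw [hP0, mul_zero]

variable (hμ1 : ∀ k, ∑ x, μ k x = 1) (hP : IsRowStochastic P) (hup : ∀ p q, P p q ≠ 0 → (q.1 : ℕ) ≤ p.1 + 1)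
include hμ1 hP hup

/-- **`(K − n) ≤ (K+1)·d(n)`** for every level scheme rising at most one level per step (no stationarity, no
reversibility). [ours] -/
theorem levelRise_worstTvDist_ge (n : ℕ) : (K : ℝ) - n ≤ (K + 1) * worstTvDist P (stFinLaw μ) n := by
  have hK : (0 : ℝ) < K + 1 := by positivity
  haveI : Nonempty S := by
    by_contra h
    have := hμ1 0
    rw [not_nonempty_iff] at h
    rw [Finset.univ_eq_empty, Finset.sum_empty] at this
    exact zero_ne_one this
  obtain ⟨x₀⟩ := (inferInstance : Nonempty S)
  rcases (le_or_gt n K : n ≤ K ∨ K < n) with hn | hn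
  · -- the levels above `n`
    set C : Finset (Fin (K + 1)) := univ.filter (fun k : Fin (K + 1) => n < (k : ℕ)) with hC
    set T : Finset (Fin (K + 1) × S) := univ.filter (fun p : Fin (K + 1) × S => p.1 ∈ C) with hT
    have hcard : C.card = K - n := by
      have e : C = Finset.Ioi (⟨n, by omega⟩ : Fin (K + 1)) := by
        ext k
        simp [hC, Fin.lt_def]
      rw [e, Fin.card_Ioi]
      simp
    have hmassT : ∑ p ∈ T, stFinLaw μ p = ((K : ℝ) - n) / (K + 1) := by
      rw [hT, stFin_mass_levelSet hμ1 C, hcard, Nat.cast_sub hn]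
    set ν := lawAt P (Pi.single ((0 : Fin (K + 1)), x₀) 1) n with hν
    have hνT : ∑ p ∈ T, ν p = 0 := by
      refine sum_eq_zero fun q hq' => ?_
      rw [hT, mem_filter, hC, mem_filter] at hq'
      exact lawAt_single_eq_zero_above hup x₀ n q hq'.2.2
    have hmass : ∑ p, stFinLaw μ p = ∑ p, ν p := by
      rw [sum_stFinLaw hμ1, hν, sum_lawAt hP, Finset.sum_pi_single']
      simp
    have hev := sub_sum_le_tvDist hmass T
    rw [hmassT, hνT, sub_zero, tvDist_comm, div_le_iff₀ hK] at hev
    have hd := tvDist_single_le_worstTvDist P (stFinLaw μ) n ((0 : Fin (K + 1)), x₀)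
    rw [← hν] at hd
    calc (K : ℝ) - n ≤ tvDist ν (stFinLaw μ) * (K + 1) := hev
      _ ≤ worstTvDist P (stFinLaw μ) n * (K + 1) := mul_le_mul_of_nonneg_right hd hK.le
      _ = (K + 1) * worstTvDist P (stFinLaw μ) n := mul_comm _ _
  · have h0 := worstTvDist_nonneg P (stFinLaw μ) n
    have : (K : ℝ) < n := by exact_mod_cast hn
    nlinarith

/-- **THE BALLISTIC FLOOR: `d(n) ≤ ¼ ⇒ 3K ≤ 4n + 1`** — no level scheme rising one level per step is `¼`-mixed before
`(3K − 1)/4` steps. [ours] -/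
theorem levelRise_mixing_floor {n : ℕ} (hn : worstTvDist P (stFinLaw μ) n ≤ 1 / 4) : 3 * K ≤ 4 * n + 1 := by
  have h := levelRise_worstTvDist_ge hμ1 hP hup n
  have hK : (0 : ℝ) ≤ K + 1 := by positivity
  have h' : (K : ℝ) - n ≤ (K + 1) * (1 / 4) := h.trans (mul_le_mul_of_nonneg_left hn hK)
  have h'' : (3 * K : ℝ) ≤ 4 * n + 1 := by linarith
  exact_mod_cast h''

/-- **`3K ≤ 4·t_mix + 1`** (the chain being `¼`-close to the target at some time). [ours] -/
theorem levelRise_mixingTime_ge (hmix : ∃ n, worstTvDist P (stFinLaw μ) n ≤ 1 / 4) :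
    3 * K ≤ 4 * mixingTime P (stFinLaw μ) (1 / 4) + 1 := by
  obtain ⟨n, hn⟩ := hmix
  exact levelRise_mixing_floor hμ1 hP hup (worstTvDist_mixingTime_le P (stFinLaw μ) hn)

end Rise

/-! ## §3 Instances: every level scheme `t·Q + (1−t)·W`, and the Metropolis sampler -/

section Instances

variable [DecidableEq S] (hμ : ∀ k x, 0 < μ k x) (hμ1 : ∀ k, ∑ x, μ k x = 1) (hM : ∀ k, IsRowStochastic (M k))
  (ht0 : 0 ≤ t) (ht1 : t ≤ 1)
include hμ1 hM ht0 ht1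

/-- **EVERY LEVEL SCHEME, REVERSIBLE OR NOT:** `Q` any row-stochastic level move rising at most one level per step
(`Q(p,q) ≠ 0 ⇒ q.1 ≤ p.1 + 1`), `W = stFinWithin M`, `0 ≤ t ≤ 1`: `d(n) ≤ ¼ ⇒ 3K ≤ 4n + 1`. [ours] -/
theorem levelScheme_mixing_ballistic {Q : Matrix (Fin (K + 1) × S) (Fin (K + 1) × S) ℝ} (hQ : IsRowStochastic Q)
    (hQup : ∀ p q, Q p q ≠ 0 → (q.1 : ℕ) ≤ p.1 + 1) {n : ℕ}
    (hn : worstTvDist (fun p q : Fin (K + 1) × S => t * Q p q + (1 - t) * stFinWithin M p q) (stFinLaw μ) n ≤ 1 / 4) :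
    3 * K ≤ 4 * n + 1 := by
  have hW := stFinWithin_isRowStochastic (K := K) hM
  have hP : IsRowStochastic (fun p q : Fin (K + 1) × S => t * Q p q + (1 - t) * stFinWithin M p q) := by
    refine ⟨fun p q => add_nonneg (mul_nonneg ht0 (hQ.1 p q)) (mul_nonneg (by linarith) (hW.1 p q)), fun p => ?_⟩
    simp only
    rw [sum_add_distrib, ← mul_sum, ← mul_sum, hQ.2 p, hW.2 p]; ring
  refine levelRise_mixing_floor hμ1 hP (fun p q h => ?_) hn
  by_contra hlt
  have hQ0 : Q p q = 0 := by by_contra h'; exact hlt (hQup p q h')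
  have hW0 : stFinWithin M p q = 0 := by
    rw [stFinWithin_apply, if_neg]
    intro e
    rw [e] at hlt
    omega
  exact h (by simp only [hQ0, hW0, mul_zero, add_zero])

include hμ

/-- **THE METROPOLIS SAMPLER:** `d(n) ≤ ¼ ⇒ 3K ≤ 4n + 1` for `stFinSampler t μ M`, whatever the within-level updates. [ours] -/
theorem stFin_mixing_ballistic {n : ℕ} (hn : worstTvDist (stFinSampler t μ M) (stFinLaw μ) n ≤ 1 / 4) :
    3 * K ≤ 4 * n + 1 := by
  refine levelScheme_mixing_ballistic hμ1 hM ht0 ht1 (stFinLevel_isRowStochastic hμ) (fun p q h => ?_) hn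
  by_contra hlt
  by_cases hqp : q = p
  · rw [hqp] at hlt; omega
  · have key := stFinLaw_mul_stFinLevel hμ hqp
    rw [if_neg] at key
    · exact (mul_ne_zero (stFinLaw_pos hμ p).ne' h) key
    · rintro ⟨-, h1 | h1⟩ <;> omega

omit hM in
/-- **REPLICA EXCHANGE, THE TAGGED REPLICA:** `d(n) ≤ ¼ ⇒ 3K ≤ 4n + 1` for `ptFinSampler t μ M` against
`ptFinLaw μ` — the tag moves one rung per accepted swap (`ptFinLaw μ` is `stFinLaw` of the constant family
`k ↦ ⊗μ`). [ours] -/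
theorem ptFin_mixing_ballistic {M' : Fin (K + 1) → S → S → ℝ} (hM' : ∀ k, IsRowStochastic (M' k)) {n : ℕ}
    (hn : worstTvDist (ptFinSampler t μ M') (ptFinLaw μ) n ≤ 1 / 4) : 3 * K ≤ 4 * n + 1 := by
  rw [show ptFinLaw μ = stFinLaw (fun _ : Fin (K + 1) => tensorFun μ) from rfl] at hn
  refine levelRise_mixing_floor (μ := fun _ : Fin (K + 1) => tensorFun μ) (fun _ => sum_tensorFun_eq_one μ hμ1)
    (ptFinSampler_isRowStochastic hμ hM' ht0 ht1) (fun p q h => ?_) hn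
  by_contra hlt
  rw [ptFinSampler_apply] at h
  have hU : ptFinUpdate M' p q = 0 := by
    rw [ptFinUpdate_apply, if_neg]
    intro e
    rw [e] at hlt
    omega
  have hqp : q ≠ p := fun e => by rw [e] at hlt; omega
  have hT : ptFinProposal p q = 0 := by
    refine sum_eq_zero fun i _ => if_neg fun hq => hlt ?_
    rw [hq]
    unfold swapAct levelSwap
    simp only
    rcases eq_or_ne p.1 i.castSucc with h1 | h1
    · rw [h1, Equiv.swap_apply_left, Fin.val_succ, Fin.val_castSucc]
    · rcases eq_or_ne p.1 i.succ with h2 | h2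
      · rw [h2, Equiv.swap_apply_right, Fin.val_succ, Fin.val_castSucc]; omega
      · rw [Equiv.swap_apply_of_ne_of_ne h1 h2]; omega
  have key := ptFinLaw_mul_ptFinSwap hμ hqp
  rw [hT, zero_mul] at key
  have hSw : ptFinSwap μ p q = 0 := (mul_eq_zero.mp key).resolve_left (ptFinLaw_pos hμ p).ne'
  exact h (by rw [hSw, hU, mul_zero, mul_zero, add_zero])

end Instances

end Summit.Ventures.LatticeQCDFlow.Scaling

end
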